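import Literature.Analysis.Complex.FourierPolyaKiKimEngine
import Literature.Analysis.Complex.HadamardGenusZeroProofs
import Literature.Analysis.TotalPositivity.PolyaFrequencyEntire
import Mathlib.Analysis.Normed.Group.Tannery
import HarnessLib

/-!
# The Fourier–Pólya theorem for real entire functions of order `< 1`, case of no critical points

Support file (5/·) for the discharge of
`Literature.Analysis.Complex.KiKim2000_thm_4_3_noCriticalPoints`
(`Literature/Analysis/Complex/FourierPolyaKiKim.lean`): Ki–Kim's Theorem 4.1 (the Fourier–Pólya
conjecture: "every real entire function of genus 0 has just as many critical points as couples of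
nonreal zeros", Duke Math. J. 104 (2000), p. 60) in the direction and special case needed for
Theorem 4.3 with `K = 0`: a real entire function `G` of order `< 1` (`IsEntireOfOrderLt 1`; such
functions have genus `0`) with `G(0) ≠ 0` whose real restriction has no Fourier critical point
has only real zeros (`im_eq_zero_of_noCrit_of_order_lt_one`).

## The proof (Ki–Kim §4, pp. 60–61, specialised)

Hadamard (`Literature.Analysis.Complex.hadamard_genus_zero_zeros`, proved in the tree):
`G(z)/G(0) = ∏ (1 - bₙ z)` with `Σ |bₙ| < ∞`; here we also need `Σ |bₙ|^τ < ∞` for some `τ < 1`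
(`summable_norm_rpow_of_fibers`, from the Jensen counting bound `HadamardGenusZero.count_le` by
the dyadic argument of the tree's `wsum_le`). Split the zeros: `h = G(0) ∏_{bₙ ∉ ℝ} (1 - bₙ z)` is
entire of order `< 1` (`norm_tprod_one_add_le_exp`), real on `ℝ` (`im_eq_zero_of_mul`) and
zero-free on `ℝ`; for `r = k + 1`, `T_k = ∏_{bₙ ∈ ℝ, |bₙ| ≤ 1/r} (1 - bₙ z) → 1` locally uniformly
(`tendstoUniformlyOn_tprod_one_add_of_tsum_tendsto_zero`, Tannery), and
`G = P_k · T_k · h` with the FINITE real-rooted `P_k = ∏_{bₙ ∈ ℝ, |bₙ| > 1/r} (1 - bₙ z)`.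
If `G` had a non-real zero, `h` would have a zero, hence a genuine Fourier critical point
(`exists_genuine_crit_of_factor`: the engine `false_of_noCrit_of_forall_ne_zero` if `h` is
transcendental — Ki–Kim's class `𝔐` Proposition —, de Gua's rule
`exists_genuine_crit_of_iteratedDeriv_eq_const` if `h` is a polynomial); by the persistence of
critical points (`eventually_not_noCrit_of_tendstoUniformlyOn`, Ki–Kim Thm 3.1) `T_k h` has one
for large `k`, while `H(G)` and Ki–Kim's Thm 3.2 (`noCrit_of_noCrit_finset_prod_mul`) give
`H(T_k h)` — contradiction. (The printed proof treats `K` critical points and uses Theorem 2.2 =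
Pólya–Wiman for finitely many non-real zeros; for `K = 0` de Gua's rule for the polynomial factor
suffices.)

## References

* H. Ki, Y.-O. Kim, Duke Math. J. 104 (2000) 45–73, §4, Theorem 4.1 and its proof pp. 60–61;
  Lindelöf's theorem p. 61 [KiKim2000].
* J. B. Conway, *Functions of One Complex Variable I*, Ch. XI Thm. 3.4 (Hadamard), as proved in
  `HadamardGenusZeroProofs.lean`.
-/

noncomputable section

open Filter Set Topology
open scoped Topology

namespace Literature.Analysis.Complex
namespace KiKim



section convergenceExponent

open _root_.Complex HadamardGenusZero

variable {f : ℂ → ℂ}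

/-- Monotonicity of `W_τ`. [folklore] -/
theorem wsumτ_mono (hf : Differentiable ℂ f) (h0 : f 0 ≠ 0) (τ : ℝ) {R R' : ℝ} (h : R ≤ R') :
    (∑ u ∈ zerosIn hf h0 R, (analyticOrderNatAt f u : ℝ) / ‖u‖ ^ τ) ≤
      (∑ u ∈ zerosIn hf h0 R', (analyticOrderNatAt f u : ℝ) / ‖u‖ ^ τ) :=
  Finset.sum_le_sum_of_subset_of_nonneg (zerosIn_mono hf h0 h) fun _ _ _ => by positivity

/-- Dyadic step: `W_τ(2R) ≤ W_τ(R) + n(2R)/R^τ` (`τ ≥ 0`). [folklore] -/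
theorem wsumτ_two_mul_le (hf : Differentiable ℂ f) (h0 : f 0 ≠ 0) {τ : ℝ} (hτ : 0 ≤ τ) {R : ℝ}
    (hR : 0 < R) :
    (∑ u ∈ zerosIn hf h0 (2 * R), (analyticOrderNatAt f u : ℝ) / ‖u‖ ^ τ) ≤
      (∑ u ∈ zerosIn hf h0 R, (analyticOrderNatAt f u : ℝ) / ‖u‖ ^ τ) + count hf h0 (2 * R) / R ^ τ := by
  classical
  rw [← Finset.sum_filter_add_sum_filter_not (zerosIn hf h0 (2 * R)) (fun u => ‖u‖ ≤ R)]
  have h1 : (zerosIn hf h0 (2 * R)).filter (fun u => ‖u‖ ≤ R) = zerosIn hf h0 R := by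
    ext u
    simp only [Finset.mem_filter, mem_zerosIn]
    constructor
    · rintro ⟨⟨_, h⟩, h'⟩; exact ⟨h', h⟩
    · rintro ⟨h, h'⟩; exact ⟨⟨by linarith, h'⟩, h⟩
  rw [h1]
  gcongr
  rw [count, Nat.cast_sum, Finset.sum_div]
  calc ∑ u ∈ (zerosIn hf h0 (2 * R)).filter (fun u => ¬‖u‖ ≤ R), (analyticOrderNatAt f u : ℝ) / ‖u‖ ^ τ
      ≤ ∑ u ∈ (zerosIn hf h0 (2 * R)).filter (fun u => ¬‖u‖ ≤ R), (analyticOrderNatAt f u : ℝ) / R ^ τ := by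
        refine Finset.sum_le_sum fun u hu => ?_
        rw [Finset.mem_filter, not_le] at hu
        exact div_le_div_of_nonneg_left (by positivity) (by positivity)
          (Real.rpow_le_rpow hR.le hu.2.le hτ)
    _ ≤ ∑ u ∈ zerosIn hf h0 (2 * R), (analyticOrderNatAt f u : ℝ) / R ^ τ :=
        Finset.sum_le_sum_of_subset_of_nonneg (Finset.filter_subset _ _) fun _ _ _ => by positivity

/-- Dyadic bound for `W_τ(2^K)`. [folklore] -/
theorem wsumτ_two_pow_le (hf : Differentiable ℂ f) (h0 : f 0 ≠ 0) {τ : ℝ} (hτ : 0 ≤ τ) (K : ℕ) :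
    (∑ u ∈ zerosIn hf h0 (2 ^ K), (analyticOrderNatAt f u : ℝ) / ‖u‖ ^ τ) ≤
      (∑ u ∈ zerosIn hf h0 1, (analyticOrderNatAt f u : ℝ) / ‖u‖ ^ τ) +
      ∑ k ∈ Finset.range K, (count hf h0 (2 ^ (k + 1)) : ℝ) / ((2:ℝ) ^ k) ^ τ := by
  induction K with
  | zero => simp
  | succ K ih =>
    rw [Finset.sum_range_succ, pow_succ, mul_comm]
    have := wsumτ_two_mul_le hf h0 hτ (R := 2 ^ K) (by positivity)
    rw [show (2 : ℝ) * 2 ^ K = 2 ^ (K + 1) by ring] at this ⊢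
    linarith

/-- **Convergence exponent `< 1`**: with growth of order `σ < 1` and `σ < τ`, `0 < τ`,
`W_τ(R)` is bounded (dyadic decomposition + Jensen). [folklore] -/
theorem wsumτ_le (hf : Differentiable ℂ f) (h0 : f 0 ≠ 0) {σ C τ : ℝ} (hσ1 : σ < 1) (hC : 1 ≤ C)
    (hb : ∀ z : ℂ, ‖f z‖ ≤ C * Real.exp (‖z‖ ^ σ)) (hστ : σ < τ) (hτ0 : 0 < τ) :
    ∃ c : ℝ, ∀ R : ℝ, (∑ u ∈ zerosIn hf h0 R, (analyticOrderNatAt f u : ℝ) / ‖u‖ ^ τ) ≤ c := by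
  set K₀ := (Real.log C - Real.log ‖f 0‖) / Real.log 2 with hK₀
  set K₁ := 2 / Real.log 2 with hK₁
  have hK₁ : 0 ≤ K₁ := by rw [hK₁]; have := Real.log_pos (by norm_num : (1 : ℝ) < 2); positivity
  set q : ℝ := (2 : ℝ) ^ (σ - τ) with hq
  have hq0 : 0 < q := Real.rpow_pos_of_pos (by norm_num) _
  have hq1 : q < 1 := Real.rpow_lt_one_of_one_lt_of_neg (by norm_num) (by linarith)
  set p : ℝ := (2 : ℝ) ^ (-τ) with hp
  have hp0 : 0 < p := Real.rpow_pos_of_pos (by norm_num) _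
  have hp1 : p < 1 := Real.rpow_lt_one_of_one_lt_of_neg (by norm_num) (by linarith)
  -- termwise bound
  have hterm : ∀ k : ℕ, (count hf h0 (2 ^ (k + 1)) : ℝ) / ((2:ℝ) ^ k) ^ τ ≤
      |K₀| * p ^ k + K₁ * (2 : ℝ) ^ σ * q ^ k := by
    intro k
    have hc := count_le hf h0 hσ1.le hC hb (r := 2 ^ (k + 1)) (by positivity)
    have h2k : ((2:ℝ) ^ k) ^ τ = (2:ℝ) ^ ((k:ℝ) * τ) := by
      rw [← Real.rpow_natCast, ← Real.rpow_mul (by norm_num)]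
    have h1 : ((2 : ℝ) ^ (k + 1)) ^ σ = (2 : ℝ) ^ σ * q ^ k * ((2:ℝ) ^ k) ^ τ := by
      rw [h2k, hq, ← Real.rpow_natCast 2 (k + 1), ← Real.rpow_mul (by norm_num),
        ← Real.rpow_natCast ((2:ℝ) ^ (σ - τ)) k, ← Real.rpow_mul (by norm_num),
        ← Real.rpow_add (by norm_num), ← Real.rpow_add (by norm_num)]
      congr 1; push_cast; ring
    have hpk : p ^ k * ((2:ℝ) ^ k) ^ τ = 1 := by
      rw [h2k, hp, ← Real.rpow_natCast ((2:ℝ) ^ (-τ)) k, ← Real.rpow_mul (by norm_num),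
        ← Real.rpow_add (by norm_num)]
      have : -τ * (k:ℝ) + (k:ℝ) * τ = 0 := by ring
      rw [this, Real.rpow_zero]
    rw [h1] at hc
    rw [div_le_iff₀ (by positivity)]
    calc (count hf h0 (2 ^ (k + 1)) : ℝ) ≤ K₀ + K₁ * ((2 : ℝ) ^ σ * q ^ k * ((2:ℝ) ^ k) ^ τ) := hc
      _ ≤ |K₀| * 1 + K₁ * ((2 : ℝ) ^ σ * q ^ k * ((2:ℝ) ^ k) ^ τ) := by
          have := le_abs_self K₀; linarith
      _ = |K₀| * (p ^ k * ((2:ℝ) ^ k) ^ τ) + K₁ * ((2 : ℝ) ^ σ * q ^ k * ((2:ℝ) ^ k) ^ τ) := by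
          rw [hpk]
      _ = (|K₀| * p ^ k + K₁ * (2 : ℝ) ^ σ * q ^ k) * ((2:ℝ) ^ k) ^ τ := by ring
  refine ⟨(∑ u ∈ zerosIn hf h0 1, (analyticOrderNatAt f u : ℝ) / ‖u‖ ^ τ) + (|K₀| / (1 - p) + K₁ * (2 : ℝ) ^ σ / (1 - q)), fun R => ?_⟩
  obtain ⟨K, hK⟩ := pow_unbounded_of_one_lt R (by norm_num : (1 : ℝ) < 2)
  refine (wsumτ_mono hf h0 τ hK.le).trans ((wsumτ_two_pow_le hf h0 hτ0.le K).trans ?_)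
  gcongr
  calc ∑ k ∈ Finset.range K, (count hf h0 (2 ^ (k + 1)) : ℝ) / ((2:ℝ) ^ k) ^ τ
      ≤ ∑ k ∈ Finset.range K, (|K₀| * p ^ k + K₁ * (2 : ℝ) ^ σ * q ^ k) :=
        Finset.sum_le_sum fun k _ => hterm k
    _ = |K₀| * ∑ k ∈ Finset.range K, p ^ k +
          K₁ * (2 : ℝ) ^ σ * ∑ k ∈ Finset.range K, q ^ k := by
        rw [Finset.sum_add_distrib, Finset.mul_sum, Finset.mul_sum]
    _ ≤ |K₀| / (1 - p) + K₁ * (2 : ℝ) ^ σ / (1 - q) := by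
        have h1 : ∑ k ∈ Finset.range K, p ^ k ≤ 1 / (1 - p) := by
          have := geom_sum_Ico_le_of_lt_one hp0.le hp1 (m := 0) (n := K)
          rw [← Finset.range_eq_Ico, pow_zero] at this
          exact this
        have h2 : ∑ k ∈ Finset.range K, q ^ k ≤ 1 / (1 - q) := by
          have := geom_sum_Ico_le_of_lt_one hq0.le hq1 (m := 0) (n := K)
          rw [← Finset.range_eq_Ico, pow_zero] at this
          exact this
        have h3 : 0 ≤ K₁ * (2 : ℝ) ^ σ := by positivity
        have h4 : 0 ≤ |K₀| := abs_nonneg _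
        calc |K₀| * ∑ k ∈ Finset.range K, p ^ k + K₁ * (2 : ℝ) ^ σ * ∑ k ∈ Finset.range K, q ^ k
            ≤ |K₀| * (1 / (1 - p)) + K₁ * (2 : ℝ) ^ σ * (1 / (1 - q)) := by gcongr
          _ = |K₀| / (1 - p) + K₁ * (2 : ℝ) ^ σ / (1 - q) := by ring


/-- **Summability of `|bₙ|^τ` for the Hadamard data** (`bₙ` = inverses of the zeros with
multiplicity, as in `hadamard_genus_zero_zeros`): `Σ |bₙ|^τ < ∞` for `σ < τ`, `0 < τ`, i.e.
the convergence exponent of the zeros of an entire function of order `σ < 1` is `≤ σ`. [folklore] -/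
theorem summable_norm_rpow_of_fibers (hf : Differentiable ℂ f) (h0 : f 0 ≠ 0) {σ C τ : ℝ}
    (hσ1 : σ < 1) (hC : 1 ≤ C) (hb : ∀ z : ℂ, ‖f z‖ ≤ C * Real.exp (‖z‖ ^ σ)) (hστ : σ < τ)
    (hτ0 : 0 < τ) {b : ℕ → ℂ} (hzero : ∀ n, b n ≠ 0 → f (b n)⁻¹ = 0)
    (hfib : ∀ a : ℂ, a ≠ 0 → {n : ℕ | b n = a⁻¹}.ncard = analyticOrderNatAt f a) :
    Summable fun n => ‖b n‖ ^ τ := by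
  classical
  obtain ⟨c, hc⟩ := wsumτ_le hf h0 hσ1 hC hb hστ hτ0
  refine summable_of_sum_le (fun n => by positivity) (c := c) fun F => ?_
  set F' := F.filter (fun n => b n ≠ 0) with hF'
  have h1 : ∑ n ∈ F, ‖b n‖ ^ τ = ∑ n ∈ F', ‖b n‖ ^ τ := by
    rw [hF', Finset.sum_filter]
    refine Finset.sum_congr rfl fun n _ => ?_
    split_ifs with h
    · rfl
    · push Not at h; rw [h, norm_zero, Real.zero_rpow hτ0.ne']
  set A := F'.image (fun n => (b n)⁻¹) with hA
  set R := ∑ a ∈ A, ‖a‖ with hR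
  have hAz : A ⊆ zerosIn hf h0 R := by
    intro a ha
    rw [mem_zerosIn]
    obtain ⟨n, hn, rfl⟩ := Finset.mem_image.mp ha
    have hbn : b n ≠ 0 := (Finset.mem_filter.mp hn).2
    exact ⟨Finset.single_le_sum (fun a _ => norm_nonneg a) ha, hzero n hbn⟩
  -- group by fibres
  have h2 : ∑ n ∈ F', ‖b n‖ ^ τ = ∑ a ∈ A, ∑ n ∈ F'.filter (fun n => (b n)⁻¹ = a), ‖b n‖ ^ τ :=
    (Finset.sum_fiberwise_of_maps_to (fun n hn => Finset.mem_image_of_mem _ hn) _).symm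
  have h3 : ∀ a ∈ A, ∑ n ∈ F'.filter (fun n => (b n)⁻¹ = a), ‖b n‖ ^ τ ≤
      (analyticOrderNatAt f a : ℝ) / ‖a‖ ^ τ := by
    intro a ha
    obtain ⟨n₀, hn₀, rfl⟩ := Finset.mem_image.mp ha
    have hbn₀ : b n₀ ≠ 0 := (Finset.mem_filter.mp hn₀).2
    have ha0 : (b n₀)⁻¹ ≠ 0 := inv_ne_zero hbn₀
    have hval : ∀ n ∈ F'.filter (fun n => (b n)⁻¹ = (b n₀)⁻¹), ‖b n‖ ^ τ = (‖(b n₀)⁻¹‖ ^ τ)⁻¹ := by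
      intro n hn
      have := (Finset.mem_filter.mp hn).2
      rw [inv_inj] at this
      rw [this, norm_inv, Real.inv_rpow (norm_nonneg _), inv_inv]
    rw [Finset.sum_congr rfl hval, Finset.sum_const, nsmul_eq_mul, div_eq_mul_inv]
    gcongr
    -- the fibre in `F'` is part of the full fibre, which has `analyticOrderNatAt f a` elements
    have hsub : (↑(F'.filter (fun n => (b n)⁻¹ = (b n₀)⁻¹)) : Set ℕ) ⊆ {n : ℕ | b n = ((b n₀)⁻¹)⁻¹} := by
      intro n hn
      have := (Finset.mem_filter.mp (Finset.mem_coe.mp hn)).2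
      rw [inv_inj] at this
      simp [this]
    have hord : analyticOrderNatAt f (b n₀)⁻¹ ≠ 0 :=
      (analyticOrderNatAt_ne_zero_iff hf h0 _).mpr (hzero n₀ hbn₀)
    have hfin : {n : ℕ | b n = ((b n₀)⁻¹)⁻¹}.Finite := by
      apply Set.finite_of_ncard_ne_zero
      rw [hfib _ ha0]; exact hord
    have := Set.ncard_le_ncard hsub hfin
    rw [Set.ncard_coe_finset, hfib _ ha0] at this
    exact_mod_cast this
  calc ∑ n ∈ F, ‖b n‖ ^ τ = ∑ a ∈ A, ∑ n ∈ F'.filter (fun n => (b n)⁻¹ = a), ‖b n‖ ^ τ := by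
        rw [h1, h2]
    _ ≤ ∑ a ∈ A, (analyticOrderNatAt f a : ℝ) / ‖a‖ ^ τ := Finset.sum_le_sum h3
    _ ≤ (∑ u ∈ zerosIn hf h0 R, (analyticOrderNatAt f u : ℝ) / ‖u‖ ^ τ) :=
        Finset.sum_le_sum_of_subset_of_nonneg hAz fun _ _ _ => by positivity
    _ ≤ c := hc R

end convergenceExponent


section products

open _root_.Complex Literature.Analysis.TotalPositivity

/-- `1 + x ≤ exp (2 x^τ / τ)` for `x ≥ 0`, `0 < τ ≤ 1` (from `log y ≤ y^τ/τ` and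
`(1 + x)^τ ≤ 1 + x^τ`). [folklore] -/
theorem one_add_le_exp_rpow {x τ : ℝ} (hx : 0 ≤ x) (hτ0 : 0 < τ) (hτ1 : τ ≤ 1) :
    1 + x ≤ Real.exp (2 * x ^ τ / τ) := by
  rcases le_or_gt x 1 with h | h
  · -- `x ≤ 1`: `1 + x ≤ e^x ≤ exp(x^τ) ≤ exp(2 x^τ/τ)`
    have h1 : x ≤ x ^ τ := by
      rcases eq_or_lt_of_le hx with h0 | h0
      · rw [← h0, Real.zero_rpow hτ0.ne']
      · exact Real.rpow_le_rpow_of_exponent_ge h0 h hτ1 |> fun h' => by rwa [Real.rpow_one] at h'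
    have h2 : x ^ τ ≤ 2 * x ^ τ / τ := by
      rw [le_div_iff₀ hτ0]
      have : 0 ≤ x ^ τ := Real.rpow_nonneg hx τ
      nlinarith
    calc 1 + x ≤ Real.exp x := by have := Real.add_one_le_exp x; linarith
      _ ≤ Real.exp (2 * x ^ τ / τ) := Real.exp_le_exp.mpr (h1.trans h2)
  · -- `x > 1`: `log (1 + x) ≤ (1 + x)^τ/τ ≤ (1 + x^τ)/τ ≤ 2 x^τ/τ`
    have h1x : 0 < 1 + x := by linarith
    rw [← Real.log_le_iff_le_exp h1x]
    calc Real.log (1 + x) ≤ (1 + x) ^ τ / τ := Real.log_le_rpow_div h1x.le hτ0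
      _ ≤ (1 + x ^ τ) / τ := by
          gcongr
          have := Real.rpow_add_le_add_rpow zero_le_one hx hτ0.le hτ1
          rwa [Real.one_rpow] at this
      _ ≤ 2 * x ^ τ / τ := by
          gcongr
          have : 1 ≤ x ^ τ := Real.one_le_rpow h.le hτ0.le
          linarith

variable {a : ℕ → ℂ}

/-- Finite products: `‖∏ (1 + aₙ z)‖ ≤ exp ((2/τ) ‖z‖^τ Σ ‖aₙ‖^τ)`. [folklore] -/
theorem norm_prod_one_add_le_exp (s : Finset ℕ) (z : ℂ) {τ : ℝ} (hτ0 : 0 < τ) (hτ1 : τ ≤ 1) :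
    ‖∏ n ∈ s, (1 + a n * z)‖ ≤ Real.exp (2 / τ * ‖z‖ ^ τ * ∑ n ∈ s, ‖a n‖ ^ τ) := by
  classical
  induction s using Finset.induction_on with
  | empty => simp
  | insert n s hn ih =>
    rw [Finset.prod_insert hn, Finset.sum_insert hn, norm_mul, mul_add, Real.exp_add]
    refine mul_le_mul ?_ ih (norm_nonneg _) (Real.exp_pos _).le
    calc ‖1 + a n * z‖ ≤ 1 + ‖a n * z‖ := by
          have := norm_add_le (1 : ℂ) (a n * z); rwa [norm_one] at this
      _ ≤ Real.exp (2 * ‖a n * z‖ ^ τ / τ) := one_add_le_exp_rpow (norm_nonneg _) hτ0 hτ1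
      _ = Real.exp (2 / τ * ‖z‖ ^ τ * ‖a n‖ ^ τ) := by
          rw [norm_mul, Real.mul_rpow (norm_nonneg _) (norm_nonneg _)]; ring_nf

/-- **Growth of a genus-zero canonical product with convergence exponent `≤ τ`**:
`‖∏' (1 + aₙ z)‖ ≤ exp ((2/τ) (Σ' ‖aₙ‖^τ) ‖z‖^τ)`. [folklore] -/
theorem norm_tprod_one_add_le_exp (ha : Summable fun n => ‖a n‖) {τ : ℝ} (hτ0 : 0 < τ) (hτ1 : τ ≤ 1)
    (hτ : Summable fun n => ‖a n‖ ^ τ) (z : ℂ) :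
    ‖∏' n, (1 + a n * z)‖ ≤ Real.exp (2 / τ * (∑' n, ‖a n‖ ^ τ) * ‖z‖ ^ τ) := by
  have hP := (continuous_norm.tendsto _).comp (hasProd_one_add ha z)
  refine le_of_tendsto' hP fun s => ?_
  refine (norm_prod_one_add_le_exp s z hτ0 hτ1).trans (Real.exp_le_exp.mpr ?_)
  rw [mul_assoc, mul_assoc, mul_comm (‖z‖ ^ τ)]
  gcongr
  exact hτ.sum_le_tsum s (fun n _ => by positivity)

/-- `‖∏' (1 + aₙ z) - 1‖ ≤ exp (‖z‖ Σ' ‖aₙ‖) - 1`. [folklore] -/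
theorem norm_tprod_one_add_sub_one_le (ha : Summable fun n => ‖a n‖) (z : ℂ) :
    ‖∏' n, (1 + a n * z) - 1‖ ≤ Real.exp (‖z‖ * ∑' n, ‖a n‖) - 1 := by
  have hP := (continuous_norm.tendsto _).comp
    ((continuous_sub_right (1:ℂ)).tendsto _ |>.comp (hasProd_one_add ha z))
  refine le_of_tendsto' hP fun s => ?_
  simp only [Function.comp_apply]
  refine (Finset.norm_prod_one_add_sub_one_le s _).trans ?_
  gcongr
  calc ∑ n ∈ s, ‖a n * z‖ = ‖z‖ * ∑ n ∈ s, ‖a n‖ := by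
        rw [Finset.mul_sum]; refine Finset.sum_congr rfl fun n _ => ?_; rw [norm_mul, mul_comm]
    _ ≤ ‖z‖ * ∑' n, ‖a n‖ := by
        gcongr; exact ha.sum_le_tsum s (fun n _ => norm_nonneg _)

/-- A canonical product with real coefficients is real on the real axis. [folklore] -/
theorem im_tprod_one_add_ofReal (ha : Summable fun n => ‖a n‖) (hreal : ∀ n, (a n).im = 0)
    (x : ℝ) : (∏' n, (1 + a n * x)).im = 0 := by
  have hP := Complex.continuous_im.continuousAt.tendsto.comp (hasProd_one_add ha (x : ℂ))
  refine tendsto_nhds_unique hP (tendsto_const_nhds.congr fun s => ?_)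
  simp only [Function.comp_apply]
  symm
  induction s using Finset.cons_induction with
  | empty => simp
  | cons n s hn ih =>
    have h1 : (1 + a n * (x : ℂ)).im = 0 := by simp [hreal n]
    rw [Finset.prod_cons, Complex.mul_im, ih, mul_zero, zero_add, h1, zero_mul]

/-- A canonical product with no real non-zero coefficient... rather: whose non-zero coefficients
are all non-real, has no real zeros. [folklore] -/
theorem tprod_one_add_ofReal_ne_zero (ha : Summable fun n => ‖a n‖)
    (hnr : ∀ n, a n ≠ 0 → (a n).im ≠ 0) (x : ℝ) : ∏' n, (1 + a n * x) ≠ 0 := by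
  intro h
  obtain ⟨n, hn⟩ := exists_factor_eq_zero_of_tprod_eq_zero ha h
  have han : a n ≠ 0 := by rintro h0; simp [h0] at hn
  have him := hnr n han
  have := congr_arg Complex.im hn
  simp at this
  rcases this with h1 | h1
  · exact him h1
  · subst h1; simp at hn

/-- A zero factor kills the product. [folklore] -/
theorem tprod_one_add_eq_zero_of_factor (ha : Summable fun n => ‖a n‖) {z : ℂ} {n₀ : ℕ}
    (h : 1 + a n₀ * z = 0) : ∏' n, (1 + a n * z) = 0 := by
  classical
  have hP := hasProd_one_add ha z
  refine tendsto_nhds_unique hP (tendsto_const_nhds.congr' ?_)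
  filter_upwards [Filter.eventually_ge_atTop ({n₀} : Finset ℕ)] with s hs
  exact (Finset.prod_eq_zero (hs (Finset.mem_singleton_self n₀)) h).symm

/-- **The tail products tend to `1` locally uniformly**: if `Σ' ‖cₖ n‖ → 0` along a filter, then
`∏' (1 + cₖ n z) → 1` uniformly on bounded sets. [folklore] -/
theorem tendstoUniformlyOn_tprod_one_add_of_tsum_tendsto_zero {ι : Type*} {p : Filter ι}
    {c : ι → ℕ → ℂ} (hc : ∀ k, Summable fun n => ‖c k n‖)
    (h0 : Tendsto (fun k => ∑' n, ‖c k n‖) p (𝓝 0)) (R : ℝ) :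
    TendstoUniformlyOn (fun k z => ∏' n, (1 + c k n * z)) (fun _ => 1) p (Metric.closedBall 0 R) := by
  rw [Metric.tendstoUniformlyOn_iff]
  intro ε hε
  -- choose `δ` with `exp (R δ) - 1 < ε`
  have hcont : ContinuousAt (fun s : ℝ => Real.exp (|R| * s) - 1) 0 := by fun_prop
  have hev : ∀ᶠ s in 𝓝 (0:ℝ), Real.exp (|R| * s) - 1 < ε := by
    have := hcont.eventually (Iio_mem_nhds (by simpa using hε))
    exact this
  filter_upwards [h0.eventually hev] with k hk z hz
  rw [dist_comm, dist_eq_norm]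
  refine (norm_tprod_one_add_sub_one_le (hc k) z).trans_lt (lt_of_le_of_lt ?_ hk)
  have hS : 0 ≤ ∑' n, ‖c k n‖ := tsum_nonneg fun n => norm_nonneg (c k n)
  have hzR : ‖z‖ ≤ |R| := (mem_closedBall_zero_iff.mp hz).trans (le_abs_self R)
  exact sub_le_sub_right (Real.exp_le_exp.mpr (mul_le_mul_of_nonneg_right hzR hS)) 1

end products


section genusZero

open _root_.Complex Literature.Analysis.TotalPositivity HadamardGenusZero

/-! ## Small tools -/

/-- Growth `A exp (B ‖z‖^τ)` with `τ < 1` is order `< 1` in the tree's sense. [folklore] -/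
theorem isEntireOfOrderLt_one_of_exp_bound {h : ℂ → ℂ} (hd : Differentiable ℂ h) {A B τ : ℝ}
    (hA : 0 ≤ A) (hB : 0 ≤ B) (hτ0 : 0 ≤ τ) (hτ1 : τ < 1)
    (hgr : ∀ z, ‖h z‖ ≤ A * Real.exp (B * ‖z‖ ^ τ)) : IsEntireOfOrderLt 1 h := by
  set τ' := (τ + 1) / 2 with hτ'
  have hττ' : τ < τ' := by rw [hτ']; linarith
  have hτ'1 : τ' < 1 := by rw [hτ']; linarith
  have hd0 : 0 < τ' - τ := by linarith
  set R₀ : ℝ := max 1 (B ^ (1 / (τ' - τ))) with hR₀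
  have hR₀1 : 1 ≤ R₀ := le_max_left _ _
  have hkey : ∀ z : ℂ, B * ‖z‖ ^ τ ≤ ‖z‖ ^ τ' + B * R₀ ^ τ := by
    intro z
    rcases le_or_gt ‖z‖ R₀ with hz | hz
    · have : B * ‖z‖ ^ τ ≤ B * R₀ ^ τ :=
        mul_le_mul_of_nonneg_left (Real.rpow_le_rpow (norm_nonneg _) hz hτ0) hB
      have h2 : 0 ≤ ‖z‖ ^ τ' := by positivity
      linarith
    · have hz1 : 1 ≤ ‖z‖ := hR₀1.trans hz.le
      have hBR : B ≤ R₀ ^ (τ' - τ) := by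
        have h1 : B ^ (1 / (τ' - τ)) ≤ R₀ := le_max_right _ _
        calc B = (B ^ (1 / (τ' - τ))) ^ (τ' - τ) := by
              rw [← Real.rpow_mul hB, one_div_mul_cancel hd0.ne', Real.rpow_one]
          _ ≤ R₀ ^ (τ' - τ) := Real.rpow_le_rpow (by positivity) h1 hd0.le
      have hzpow : R₀ ^ (τ' - τ) ≤ ‖z‖ ^ (τ' - τ) := Real.rpow_le_rpow (by positivity) hz.le hd0.le
      calc B * ‖z‖ ^ τ ≤ ‖z‖ ^ (τ' - τ) * ‖z‖ ^ τ := by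
            gcongr; exact hBR.trans hzpow
        _ = ‖z‖ ^ τ' := by
            rw [← Real.rpow_add (by linarith)]; ring_nf
        _ ≤ ‖z‖ ^ τ' + B * R₀ ^ τ := by
            have : 0 ≤ B * R₀ ^ τ := by positivity
            linarith
  refine ⟨hd, τ', A * Real.exp (B * R₀ ^ τ), hτ'1, fun z => ?_⟩
  calc ‖h z‖ ≤ A * Real.exp (B * ‖z‖ ^ τ) := hgr z
    _ ≤ A * Real.exp (‖z‖ ^ τ' + B * R₀ ^ τ) := by gcongr; exact hkey z
    _ = A * Real.exp (B * R₀ ^ τ) * Real.exp (‖z‖ ^ τ') := by rw [Real.exp_add]; ring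

/-- An entire function vanishing on `ℝ` vanishes identically. [folklore] -/
theorem entire_eq_zero_of_forall_ofReal {g : ℂ → ℂ} (hg : Differentiable ℂ g)
    (h : ∀ x : ℝ, g x = 0) : g = 0 := by
  have htend : Tendsto (fun x : ℝ => (x : ℂ)) (𝓝[≠] 0) (𝓝[≠] 0) :=
    Complex.continuous_ofReal.continuousWithinAt.tendsto_nhdsWithin fun x hx => by
      simpa using hx
  have hfreq : ∃ᶠ w in 𝓝[≠] (0 : ℂ), g w = 0 :=
    htend.frequently (Eventually.of_forall fun x => by simpa using h x).frequently
  funext z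
  exact (hg.differentiableOn.analyticOnNhd isOpen_univ).eqOn_zero_of_preconnected_of_frequently_eq_zero
    isPreconnected_univ (Set.mem_univ 0) hfreq (Set.mem_univ z)

/-- Real zeros of an entire `D ≢ 0` are isolated, seen from `ℝ`. [folklore] -/
theorem eventually_ne_zero_ofReal {D : ℂ → ℂ} (hD : Differentiable ℂ D) {z₁ : ℂ} (hz₁ : D z₁ ≠ 0)
    (x₀ : ℝ) : ∀ᶠ x : ℝ in 𝓝[≠] x₀, D x ≠ 0 := by
  have htend : Tendsto (fun x : ℝ => (x : ℂ)) (𝓝[≠] x₀) (𝓝[≠] (x₀ : ℂ)) :=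
    Complex.continuous_ofReal.continuousWithinAt.tendsto_nhdsWithin fun x hx => by
      simpa using hx
  rcases (hD.analyticAt (x₀ : ℂ)).eventually_eq_zero_or_eventually_ne_zero with h | h
  · exfalso
    apply hz₁
    exact (hD.differentiableOn.analyticOnNhd isOpen_univ).eqOn_zero_of_preconnected_of_eventuallyEq_zero
      isPreconnected_univ (Set.mem_univ (x₀ : ℂ)) h (Set.mem_univ z₁)
  · exact htend.eventually h

/-- Realness of a quotient: if `D` and `D·h` are real on `ℝ`, `D` entire and `≢ 0`, then `h` is
real on `ℝ` (first off the real zeros of `D`, then everywhere by continuity). [folklore] -/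
theorem im_eq_zero_of_mul {D h : ℂ → ℂ} (hD : Differentiable ℂ D) (hh : Differentiable ℂ h)
    {z₁ : ℂ} (hz₁ : D z₁ ≠ 0) (hDr : ∀ x : ℝ, (D x).im = 0) (hDh : ∀ x : ℝ, (D x * h x).im = 0)
    (x₀ : ℝ) : (h x₀).im = 0 := by
  have hoff : ∀ x : ℝ, D x ≠ 0 → (h x).im = 0 := by
    intro x hx
    have h1 := hDh x
    rw [Complex.mul_im, hDr x, zero_mul, add_zero] at h1
    rcases mul_eq_zero.mp h1 with h2 | h2
    · exfalso; apply hx; exact Complex.ext (by simpa using h2) (by simpa using hDr x)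
    · exact h2
  have hcont : Continuous fun x : ℝ => (h x).im :=
    Complex.continuous_im.comp (hh.continuous.comp Complex.continuous_ofReal)
  have hev : ∀ᶠ x : ℝ in 𝓝[≠] x₀, (h x).im = 0 :=
    (eventually_ne_zero_ofReal hD hz₁ x₀).mono fun x hx => hoff x hx
  have h1 : Tendsto (fun x : ℝ => (h x).im) (𝓝[≠] x₀) (𝓝 ((h x₀).im)) :=
    (hcont.tendsto x₀).mono_left nhdsWithin_le_nhds
  have h2 : Tendsto (fun x : ℝ => (h x).im) (𝓝[≠] x₀) (𝓝 0) :=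
    tendsto_const_nhds.congr' (hev.mono fun x hx => hx.symm)
  exact tendsto_nhds_unique h1 h2

/-- Lemma T along a finite set of real linear factors. [cite: KiKim2000, Corollary to Theorem 3.2] -/
theorem noCrit_of_noCrit_finset_prod_mul {ψ : ℝ → ℝ} (hψ : ∀ x, AnalyticAt ℝ ψ x) (β : ℕ → ℝ)
    (s : Finset ℕ) (hβ : ∀ n ∈ s, β n ≠ 0)
    (h : HasNoFourierCriticalPoint (fun t => (∏ n ∈ s, (1 - β n * t)) * ψ t)) :
    HasNoFourierCriticalPoint ψ := by
  classical
  induction s using Finset.induction_on generalizing ψ with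
  | empty => simpa using h
  | insert n s hn ih =>
    have hβn : β n ≠ 0 := hβ n (Finset.mem_insert_self n s)
    have hrest : ∀ x, AnalyticAt ℝ (fun t => (∏ m ∈ s, (1 - β m * t)) * ψ t) x := by
      intro x
      refine (Finset.analyticAt_fun_prod s fun m _ => ?_).mul (hψ x)
      fun_prop
    have h1 : HasNoFourierCriticalPoint (fun t => (1 - t / (β n)⁻¹) * ((∏ m ∈ s, (1 - β m * t)) * ψ t)) := by
      convert h using 2 with t
      rw [Finset.prod_insert hn, div_inv_eq_mul, mul_comm t (β n)]; ring
    exact ih hψ (fun m hm => hβ m (Finset.mem_insert_of_mem hm))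
      (noCrit_of_noCrit_one_sub_div_mul hrest (inv_ne_zero hβn) h1)

/-- Terms of norm `≥ ε > 0` of a summable sequence form a finite set. [folklore] -/
theorem finite_setOf_le_norm {b : ℕ → ℂ} (hb : Summable fun n => ‖b n‖) {ε : ℝ} (hε : 0 < ε) :
    {n : ℕ | ε ≤ ‖b n‖}.Finite := by
  have ht := hb.tendsto_atTop_zero
  obtain ⟨N, hN⟩ := eventually_atTop.mp (ht.eventually (gt_mem_nhds hε))
  refine (Set.finite_lt_nat N).subset fun n hn => ?_
  by_contra hcon
  exact absurd (hN n (not_lt.mp hcon)) (not_lt.mpr hn)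

/-! ## Genuine critical points of the non-real factor -/

/-- From a Fourier critical point in the weak sense (`¬ H`) of the real restriction of an entire
function none of whose derivatives vanishes identically, a genuine one. [folklore] -/
theorem exists_genuine_of_not_noCrit {h : ℂ → ℂ} (hd : Differentiable ℂ h)
    (hreal : ∀ x : ℝ, (h x).im = 0) (hnp : ∀ k, iteratedDeriv k h ≠ 0)
    (hH : ¬ HasNoFourierCriticalPoint (fun t : ℝ => (h t).re)) :
    ∃ (l : ℕ) (c : ℝ), iteratedDeriv (l + 1) (fun t : ℝ => (h t).re) c = 0 ∧
      iteratedDeriv l (fun t : ℝ => (h t).re) c ≠ 0 ∧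
      ¬ iteratedDeriv l (fun t : ℝ => (h t).re) c * iteratedDeriv (l + 2) (fun t : ℝ => (h t).re) c < 0 ∧
      analyticOrderAt (iteratedDeriv (l + 1) (fun t : ℝ => (h t).re)) c ≠ ⊤ := by
  unfold HasNoFourierCriticalPoint at hH
  push Not at hH
  obtain ⟨l, c, h1, h0, hbad⟩ := hH
  refine ⟨l, c, h1, h0, not_lt.mpr hbad, ?_⟩
  have hA : ∀ x, AnalyticAt ℝ (iteratedDeriv (l + 1) (fun t : ℝ => (h t).re)) x :=
    analyticAt_iteratedDeriv (analyticAt_re_ofReal hd) (l + 1)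
  refine analyticOrderAt_ne_top_of_ne_zero hA ?_ c
  intro hz
  apply hnp (l + 1)
  apply entire_eq_zero_of_forall_ofReal (Literature.Analysis.TotalPositivity.differentiable_iteratedDeriv hd _)
  intro x
  apply Complex.ext
  · have := congr_fun hz x
    rw [iteratedDeriv_re_ofReal hd] at this
    simpa using this
  · simpa using im_iteratedDeriv_ofReal_eq_zero hd hreal (l + 1) x

/-- A genuine Fourier critical point of the non-real factor `h` (zero-free on `ℝ`, real, order
`< 1`, with at least one zero): from the engine if `h` is transcendental, from de Gua's rule if
`h` is a polynomial. [cite: KiKim2000, §4 (Proposition) and §1] -/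
theorem exists_genuine_crit_of_factor {h : ℂ → ℂ} (hh : IsEntireOfOrderLt 1 h)
    (hreal : ∀ x : ℝ, (h x).im = 0) (h0 : ∀ x : ℝ, h x ≠ 0) {w : ℂ} (hw : h w = 0) :
    ∃ (l : ℕ) (c : ℝ), iteratedDeriv (l + 1) (fun t : ℝ => (h t).re) c = 0 ∧
      iteratedDeriv l (fun t : ℝ => (h t).re) c ≠ 0 ∧
      ¬ iteratedDeriv l (fun t : ℝ => (h t).re) c * iteratedDeriv (l + 2) (fun t : ℝ => (h t).re) c < 0 ∧
      analyticOrderAt (iteratedDeriv (l + 1) (fun t : ℝ => (h t).re)) c ≠ ⊤ := by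
  have hd : Differentiable ℂ h := hh.1
  set hR : ℝ → ℝ := fun t => (h t).re with hRdef
  have hRa : ∀ x, AnalyticAt ℝ hR x := analyticAt_re_ofReal hd
  have hR0 : ∀ x, hR x ≠ 0 := by
    intro x hx
    apply h0 x
    exact Complex.ext (by simpa [hRdef] using hx) (by simpa using hreal x)
  by_cases hnp : ∀ k, iteratedDeriv k h ≠ 0
  · exact exists_genuine_of_not_noCrit hd hreal hnp (fun hH => false_of_noCrit_of_forall_ne_zero hh hreal h0 hH)
  · -- `h` is a polynomial
    push Not at hnp
    classical
    let m := Nat.find hnp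
    have hm : iteratedDeriv m h = 0 := Nat.find_spec hnp
    have hm0 : m ≠ 0 := by
      intro h0'
      have : h = 0 := by simpa [h0'] using hm
      exact h0 0 (by simp [this])
    obtain ⟨d, hdm⟩ : ∃ d, m = d + 1 := Nat.exists_eq_succ_of_ne_zero hm0
    have hdne : iteratedDeriv d h ≠ 0 := Nat.find_min hnp (by omega)
    have hconst : ∀ z, iteratedDeriv d h z = iteratedDeriv d h 0 := fun z =>
      is_const_of_deriv_eq_zero (Literature.Analysis.TotalPositivity.differentiable_iteratedDeriv hd d) (fun z => by
        have := congr_fun hm z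
        rw [hdm, iteratedDeriv_succ] at this
        simpa using this) z 0
    set K := iteratedDeriv d h 0 with hK
    have hK0 : K ≠ 0 := by
      intro hK0
      apply hdne
      funext z; rw [hconst z, hK0]; rfl
    have hKim : K.im = 0 := im_iteratedDeriv_ofReal_eq_zero hd hreal d 0
    have hKre : K.re ≠ 0 := by
      intro hre; apply hK0; exact Complex.ext (by simpa using hre) (by simpa using hKim)
    -- `d ≥ 1`: otherwise `h` is constant and has no zero
    have hd0 : d ≠ 0 := by
      intro hd0
      subst hd0
      have : h w = K := by simpa using hconst w
      exact hK0 (this ▸ hw)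
    obtain ⟨d', rfl⟩ := Nat.exists_eq_succ_of_ne_zero hd0
    have hRd : iteratedDeriv (d' + 1) hR = fun _ => K.re := by
      rw [hRdef, iteratedDeriv_re_ofReal hd]
      funext t
      show (iteratedDeriv (d' + 1) h t).re = K.re
      rw [hconst]
    obtain ⟨a, ha1, hbad, hfin⟩ := exists_genuine_crit_of_iteratedDeriv_eq_const hRa hKre hRd hR0
    refine ⟨0, a, by simpa using ha1, by simpa using hR0 a, ?_, by simpa using hfin⟩
    simpa [iteratedDeriv_succ] using hbad

end genusZero

section genusZeroMain

open _root_.Complex Literature.Analysis.TotalPositivity HadamardGenusZero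

/-- **The Fourier–Pólya theorem (Ki–Kim 2000, Theorem 4.1) in the case of no critical points,
for real entire functions of order `< 1`:** if `G` is real entire of order `< 1`, `G(0) ≠ 0`, and
`Re G|ℝ` has no Fourier critical point, then all zeros of `G` are real.

Proof (Ki–Kim §4, pp. 60–61, specialised to `K = 0` and with the modifications recorded in
`FourierPolyaKiKimEngine.lean`): by Hadamard's theorem (`hadamard_genus_zero_zeros`)
`G = G(0) ∏ (1 - bₙ z)`; split off the non-real zeros `h = G(0) ∏_{bₙ ∉ ℝ} (1 - bₙ z)` (entire of
order `< 1` since `Σ |bₙ|^τ < ∞` for some `τ < 1`, real and zero-free on `ℝ`). If `G` had a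
non-real zero, `h` would have a genuine Fourier critical point (`exists_genuine_crit_of_factor`:
the engine if `h` is transcendental, de Gua if it is a polynomial). The products
`G_r = h · ∏_{bₙ ∈ ℝ, |bₙ| ≤ 1/r} (1 - bₙ z)` converge to `h` with all derivatives, so `G_r` has a
Fourier critical point for large `r` (Theorem 3.1, `eventually_not_noCrit_of_tendstoUniformlyOn`);
but `G = G_r · ∏_{bₙ ∈ ℝ, |bₙ| > 1/r} (1 - bₙ z)` with a FINITE real-rooted product, so `H(G)`
gives `H(G_r)` (Theorem 3.2, `noCrit_of_noCrit_finset_prod_mul`) — a contradiction.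
[cite: KiKim2000, Theorem 4.1] -/
theorem im_eq_zero_of_noCrit_of_order_lt_one {G : ℂ → ℂ} (hG : IsEntireOfOrderLt 1 G)
    (hG0 : G 0 ≠ 0) (hreal : ∀ x : ℝ, (G x).im = 0)
    (hH : HasNoFourierCriticalPoint (fun t : ℝ => (G t).re)) (z₀ : ℂ) (hz₀ : G z₀ = 0) :
    z₀.im = 0 := by
  classical
  by_contra hz₀im
  obtain ⟨σ, C, hσ0, hσ1, hC1, hgr⟩ := exists_growth_of_isEntireOfOrderLt_one hG
  have hd : Differentiable ℂ G := hG.1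
  /- Hadamard's factorisation and the convergence exponent. -/
  obtain ⟨b, hsum, hzero, hfib, hprod⟩ := hadamard_genus_zero_zeros G σ C hd hσ1 hgr hG0
  obtain ⟨τ, hτ⟩ : ∃ τ : ℝ, τ = (σ + 1) / 2 := ⟨_, rfl⟩
  have hτ0 : 0 < τ := by rw [hτ]; linarith
  have hτ1 : τ < 1 := by rw [hτ]; linarith
  have hστ : σ < τ := by rw [hτ]; linarith
  have hbτ : Summable fun n => ‖b n‖ ^ τ :=
    summable_norm_rpow_of_fibers hd hG0 hσ1 hC1 hgr hστ hτ0 hzero hfib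
  /- An index carrying the non-real zero `z₀`. -/
  have hz₀0 : z₀ ≠ 0 := fun h => hG0 (h ▸ hz₀)
  obtain ⟨n₀, hn₀⟩ : ∃ n₀, b n₀ = z₀⁻¹ := by
    have h1 : {n : ℕ | b n = z₀⁻¹}.ncard ≠ 0 := by
      rw [hfib z₀ hz₀0]; exact (analyticOrderNatAt_ne_zero_iff hd hG0 z₀).mpr hz₀
    obtain ⟨n, hn⟩ := Set.nonempty_of_ncard_ne_zero h1
    exact ⟨n, hn⟩
  have hbn₀ : b n₀ ≠ 0 := by rw [hn₀]; exact inv_ne_zero hz₀0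
  have hbn₀im : (b n₀).im ≠ 0 := by
    intro him
    apply hz₀im
    have : z₀ = (b n₀)⁻¹ := by rw [hn₀, inv_inv]
    rw [this, Complex.inv_im, him, neg_zero, zero_div]
  /- The three coefficient sequences (`1 + a z` form, `a = -b`). -/
  obtain ⟨aN, haN⟩ : ∃ aN : ℕ → ℂ, aN = fun n => if (b n).im = 0 then 0 else -b n := ⟨_, rfl⟩
  obtain ⟨aNear, haNear⟩ : ∃ aNear : ℕ → ℕ → ℂ,
      aNear = fun k n => if (b n).im = 0 ∧ (((k:ℕ):ℝ) + 1)⁻¹ < ‖b n‖ then -b n else 0 := ⟨_, rfl⟩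
  obtain ⟨aFar, haFar⟩ : ∃ aFar : ℕ → ℕ → ℂ,
      aFar = fun k n => if (b n).im = 0 ∧ ‖b n‖ ≤ (((k:ℕ):ℝ) + 1)⁻¹ then -b n else 0 := ⟨_, rfl⟩
  have nN : ∀ n, ‖aN n‖ ≤ ‖b n‖ := fun n => by
    rw [haN]; dsimp only; split_ifs <;> simp
  have nNear : ∀ k n, ‖aNear k n‖ ≤ ‖b n‖ := fun k n => by
    rw [haNear]; dsimp only; split_ifs <;> simp
  have nFar : ∀ k n, ‖aFar k n‖ ≤ ‖b n‖ := fun k n => by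
    rw [haFar]; dsimp only; split_ifs <;> simp
  have sN : Summable fun n => ‖aN n‖ := hsum.of_nonneg_of_le (fun n => norm_nonneg _) nN
  have sNear : ∀ k, Summable fun n => ‖aNear k n‖ := fun k =>
    hsum.of_nonneg_of_le (fun n => norm_nonneg _) (nNear k)
  have sFar : ∀ k, Summable fun n => ‖aFar k n‖ := fun k =>
    hsum.of_nonneg_of_le (fun n => norm_nonneg _) (nFar k)
  have sNτ : Summable fun n => ‖aN n‖ ^ τ :=
    hbτ.of_nonneg_of_le (fun n => by positivity) fun n => Real.rpow_le_rpow (norm_nonneg _) (nN n) hτ0.le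
  -- termwise factorisation
  have hfac : ∀ k n (z : ℂ), (1 + aNear k n * z) * (1 + aFar k n * z) * (1 + aN n * z) = 1 - b n * z := by
    intro k n z
    rw [haN, haNear, haFar]; dsimp only
    by_cases h1 : (b n).im = 0
    · by_cases h2 : ((k:ℝ) + 1)⁻¹ < ‖b n‖
      · have h3 : ¬ ‖b n‖ ≤ ((k:ℝ) + 1)⁻¹ := not_le.mpr h2
        simp only [h1, h2, h3, and_true, and_false, if_true, if_false]; ring
      · have h3 : ‖b n‖ ≤ ((k:ℝ) + 1)⁻¹ := not_lt.mp h2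
        simp only [h1, h2, h3, and_true, and_false, if_true, if_false]; ring
    · simp only [h1, false_and, if_false]; ring
  /- The three products and `G = P_k · T_k · h`. -/
  obtain ⟨h, hh⟩ : ∃ h : ℂ → ℂ, h = fun z => G 0 * ∏' n, (1 + aN n * z) := ⟨_, rfl⟩
  obtain ⟨T, hT⟩ : ∃ T : ℕ → ℂ → ℂ, T = fun k z => ∏' n, (1 + aFar k n * z) := ⟨_, rfl⟩
  obtain ⟨P, hP⟩ : ∃ P : ℕ → ℂ → ℂ, P = fun k z => ∏' n, (1 + aNear k n * z) := ⟨_, rfl⟩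
  have hGfac : ∀ k z, G z = P k z * T k z * h z := by
    intro k z
    have h2 := ((hasProd_one_add (sNear k) z).mul (hasProd_one_add (sFar k) z)).mul (hasProd_one_add sN z)
    have h3 : HasProd (fun n => 1 - b n * z) ((P k z * T k z) * ∏' n, (1 + aN n * z)) := by
      rw [hP, hT]
      convert h2 using 1
      funext n
      exact (hfac k n z).symm
    have h4 := h3.unique (hprod z)
    rw [hh]; dsimp only
    rw [eq_div_iff hG0] at h4
    rw [← h4]; ring
  -- `P k` is a finite product over real zeros
  have hPfin : ∀ k : ℕ, ∃ S : Finset ℕ, (∀ n ∈ S, (b n).im = 0 ∧ ((k:ℝ) + 1)⁻¹ < ‖b n‖) ∧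
      ∀ z, P k z = ∏ n ∈ S, (1 - b n * z) := by
    intro k
    have hfin : {n : ℕ | (b n).im = 0 ∧ ((k:ℝ) + 1)⁻¹ < ‖b n‖}.Finite :=
      (finite_setOf_le_norm hsum (by positivity : (0:ℝ) < ((k:ℝ) + 1)⁻¹)).subset fun n hn => hn.2.le
    refine ⟨hfin.toFinset, fun n hn => by simpa using hn, fun z => ?_⟩
    rw [hP]; dsimp only
    rw [tprod_eq_prod (s := hfin.toFinset)]
    · refine Finset.prod_congr rfl fun n hn => ?_
      have hn' := (Set.Finite.mem_toFinset hfin).mp hn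
      rw [Set.mem_setOf_eq] at hn'
      rw [haNear]; dsimp only; rw [if_pos hn']; ring
    · intro n hn
      have hn' : ¬ ((b n).im = 0 ∧ ((k:ℝ) + 1)⁻¹ < ‖b n‖) := fun h' => hn ((Set.Finite.mem_toFinset hfin).mpr h')
      rw [haNear]; dsimp only; rw [if_neg hn']; ring
  /- Properties of `h`. -/
  have hhd : Differentiable ℂ h := by
    rw [hh]; exact (differentiable_tprod_one_add sN).const_mul _
  have hhgr : ∀ z, ‖h z‖ ≤ ‖G 0‖ * Real.exp ((2 / τ * ∑' n, ‖aN n‖ ^ τ) * ‖z‖ ^ τ) := by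
    intro z
    rw [hh]; dsimp only
    rw [norm_mul]
    exact mul_le_mul_of_nonneg_left (norm_tprod_one_add_le_exp sN hτ0 hτ1.le sNτ z) (norm_nonneg _)
  have hh1 : IsEntireOfOrderLt 1 h :=
    isEntireOfOrderLt_one_of_exp_bound hhd (norm_nonneg _)
      (mul_nonneg (by positivity) (tsum_nonneg fun n => Real.rpow_nonneg (norm_nonneg (aN n)) τ)) hτ0.le hτ1 hhgr
  have hNnonreal : ∀ n, aN n ≠ 0 → (aN n).im ≠ 0 := by
    intro n
    rw [haN]; dsimp only
    split_ifs with h1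
    · intro h; exact absurd rfl h
    · intro _; simpa using h1
  have hh0 : ∀ x : ℝ, h x ≠ 0 := fun x => by
    rw [hh]; exact mul_ne_zero hG0 (tprod_one_add_ofReal_ne_zero sN hNnonreal x)
  have hhw : h (b n₀)⁻¹ = 0 := by
    rw [hh]; dsimp only
    rw [tprod_one_add_eq_zero_of_factor sN (n₀ := n₀) ?_, mul_zero]
    rw [haN]; dsimp only
    rw [if_neg hbn₀im, neg_mul, mul_inv_cancel₀ hbn₀]; ring
  -- realness
  have hFarreal : ∀ k n, (aFar k n).im = 0 := fun k n => by
    rw [haFar]; dsimp only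
    split_ifs with h1
    · simp [h1.1]
    · simp
  have hNearreal : ∀ k n, (aNear k n).im = 0 := fun k n => by
    rw [haNear]; dsimp only
    split_ifs with h1
    · simp [h1.1]
    · simp
  have hTreal : ∀ k (x : ℝ), (T k x).im = 0 := fun k x => by
    rw [hT]; exact im_tprod_one_add_ofReal (sFar k) (hFarreal k) x
  have hPreal : ∀ k (x : ℝ), (P k x).im = 0 := fun k x => by
    rw [hP]; exact im_tprod_one_add_ofReal (sNear k) (hNearreal k) x
  have hTd : ∀ k, Differentiable ℂ (T k) := fun k => by rw [hT]; exact differentiable_tprod_one_add (sFar k)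
  have hPd : ∀ k, Differentiable ℂ (P k) := fun k => by rw [hP]; exact differentiable_tprod_one_add (sNear k)
  have hP0 : ∀ k, P k 0 = 1 := fun k => by rw [hP]; simp
  have hT0 : ∀ k, T k 0 = 1 := fun k => by rw [hT]; simp
  have him_mul : ∀ u v : ℂ, u.im = 0 → v.im = 0 → (u * v).im = 0 := fun u v hu hv => by
    rw [Complex.mul_im, hu, hv]; ring
  have hhreal : ∀ x : ℝ, (h x).im = 0 := by
    intro x
    refine im_eq_zero_of_mul (D := fun z => P 0 z * T 0 z) ((hPd 0).mul (hTd 0)) hhd (z₁ := 0)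
      (by simp [hP0, hT0]) (fun y => him_mul _ _ (hPreal 0 y) (hTreal 0 y)) (fun y => ?_) x
    have := hGfac 0 y
    rw [← this]; exact hreal y
  /- A genuine critical point of `Re h`. -/
  obtain ⟨l, c, hc1, hc0, hcbad, hcfin⟩ := exists_genuine_crit_of_factor hh1 hhreal hh0 hhw
  /- The approximants `G_k = T_k h` and their real restrictions. -/
  obtain ⟨Gk, hGk⟩ : ∃ Gk : ℕ → ℂ → ℂ, Gk = fun k z => T k z * h z := ⟨_, rfl⟩
  have hGkd : ∀ k, Differentiable ℂ (Gk k) := fun k => by rw [hGk]; exact (hTd k).mul hhd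
  -- `H` for every `G_k`
  have hHk : ∀ k, HasNoFourierCriticalPoint (fun t : ℝ => (Gk k t).re) := by
    intro k
    obtain ⟨S, hS, hPk⟩ := hPfin k
    have hβ : ∀ n ∈ S, (b n).re ≠ 0 := by
      intro n hn hre
      have h1 := hS n hn
      have : b n = 0 := Complex.ext (by simpa using hre) (by simpa using h1.1)
      rw [this, norm_zero] at h1
      exact absurd h1.2 (not_lt.mpr (by positivity))
    refine noCrit_of_noCrit_finset_prod_mul (analyticAt_re_ofReal (hGkd k)) (fun n => (b n).re) S hβ ?_
    have e : (fun t : ℝ => (G t).re) = fun t => (∏ n ∈ S, (1 - (b n).re * t)) * (Gk k t).re := by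
      funext t
      have h1 : (∏ n ∈ S, (1 - b n * (t : ℂ))) = ((∏ n ∈ S, (1 - (b n).re * t) : ℝ) : ℂ) := by
        rw [Complex.ofReal_prod]
        refine Finset.prod_congr rfl fun n hn => ?_
        apply Complex.ext <;> simp [(hS n hn).1]
      rw [hGfac k t, hPk, h1, hGk]; dsimp only
      rw [mul_assoc, Complex.re_ofReal_mul]
    rw [← e]; exact hH
  /- Uniform convergence of all derivatives near `c`. -/
  have hfar0 : Tendsto (fun k => ∑' n, ‖aFar k n‖) atTop (𝓝 0) := by
    have := tendsto_tsum_of_dominated_convergence (𝓕 := (atTop : Filter ℕ)) (f := fun k n => ‖aFar k n‖)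
      (g := fun _ => (0:ℝ)) (bound := fun n => ‖b n‖) hsum (fun n => ?_)
      (Eventually.of_forall fun k n => by rw [Real.norm_of_nonneg (norm_nonneg _)]; exact nFar k n)
    · simpa using this
    · -- pointwise: eventually `aFar k n = 0`
      by_cases hb0 : b n = 0
      · have : ∀ k, ‖aFar k n‖ = 0 := fun k => by rw [haFar]; dsimp only; simp [hb0]
        simp only [this]; exact tendsto_const_nhds
      · have hpos : 0 < ‖b n‖ := norm_pos_iff.mpr hb0
        have hev : ∀ᶠ k : ℕ in atTop, ((k:ℝ) + 1)⁻¹ < ‖b n‖ := by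
          have h1 : Tendsto (fun k : ℕ => ((k:ℝ) + 1)⁻¹) atTop (𝓝 0) :=
            tendsto_inv_atTop_zero.comp (tendsto_natCast_atTop_atTop.atTop_add tendsto_const_nhds)
          exact h1.eventually (gt_mem_nhds hpos)
        refine tendsto_const_nhds.congr' (hev.mono fun k hk => ?_)
        rw [haFar]; dsimp only
        rw [if_neg (fun h' => absurd h'.2 (not_le.mpr hk)), norm_zero]
  have hT1 : ∀ R, TendstoUniformlyOn (fun k z => T k z) (fun _ => 1) atTop (Metric.closedBall 0 R) := by
    intro R; rw [hT]; exact tendstoUniformlyOn_tprod_one_add_of_tsum_tendsto_zero sFar hfar0 R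
  have hconvC : TendstoLocallyUniformlyOn (fun k z => Gk k z) h atTop Set.univ := by
    rw [tendstoLocallyUniformlyOn_iff_forall_isCompact isOpen_univ]
    intro K _ hK
    obtain ⟨R, hR⟩ := hK.isBounded.subset_closedBall 0
    obtain ⟨M₀, hM₀⟩ := hK.exists_bound_of_continuousOn hhd.continuous.continuousOn
    obtain ⟨M, hMdef⟩ : ∃ M : ℝ, M = max M₀ 0 := ⟨_, rfl⟩
    have hM0 : 0 ≤ M := by rw [hMdef]; exact le_max_right _ _
    have hM : ∀ z ∈ K, ‖h z‖ ≤ M := fun z hz => (hM₀ z hz).trans (by rw [hMdef]; exact le_max_left _ _)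
    rw [Metric.tendstoUniformlyOn_iff]
    intro ε hε
    have hε' : 0 < ε / (M + 1) := by positivity
    filter_upwards [Metric.tendstoUniformlyOn_iff.mp (hT1 R) _ hε'] with k hk z hz
    have h1 := hk z (hR hz)
    rw [dist_eq_norm] at h1 ⊢
    rw [hGk]; dsimp only
    calc ‖h z - T k z * h z‖ = ‖1 - T k z‖ * ‖h z‖ := by rw [← norm_mul]; ring_nf
      _ ≤ ε / (M + 1) * M := mul_le_mul h1.le (hM z hz) (norm_nonneg _) hε'.le
      _ < ε := by rw [div_mul_eq_mul_div, div_lt_iff₀ (by positivity)]; nlinarith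
  have hconvD : ∀ n, TendstoLocallyUniformlyOn (fun k => iteratedDeriv n (Gk k)) (iteratedDeriv n h) atTop Set.univ :=
    fun n => tendstoLocallyUniformlyOn_iteratedDeriv isOpen_univ hGkd hconvC n
  have hconvR : ∀ n, TendstoUniformlyOn (fun k => iteratedDeriv n (fun t : ℝ => (Gk k t).re))
      (iteratedDeriv n (fun t : ℝ => (h t).re)) atTop (Icc (c - 1) (c + 1)) := by
    intro n
    have hKc : IsCompact ((fun t : ℝ => (t : ℂ)) '' Icc (c - 1) (c + 1)) :=
      isCompact_Icc.image Complex.continuous_ofReal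
    have h1 := (tendstoLocallyUniformlyOn_iff_forall_isCompact isOpen_univ).mp (hconvD n) _
      (Set.subset_univ _) hKc
    rw [Metric.tendstoUniformlyOn_iff] at h1 ⊢
    intro ε hε
    filter_upwards [h1 ε hε] with k hk t ht
    rw [iteratedDeriv_re_ofReal (hGkd k), iteratedDeriv_re_ofReal hhd]
    have h2 := hk (t : ℂ) (Set.mem_image_of_mem _ ht)
    refine lt_of_le_of_lt ?_ h2
    rw [Real.dist_eq, Complex.dist_eq, ← Complex.sub_re]
    exact Complex.abs_re_le_norm _
  /- Contradiction: `G_k` has a critical point for large `k`. -/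
  have hA3 := eventually_not_noCrit_of_tendstoUniformlyOn (analyticAt_re_ofReal hhd) hc1 hc0 hcbad hcfin
    (fun k => fun t : ℝ => (Gk k t).re) (fun k => analyticAt_re_ofReal (hGkd k)) hconvR
  obtain ⟨k, hk⟩ := hA3.exists
  exact hk (hHk k)

end genusZeroMain

end KiKim
end Literature.Analysis.Complex
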